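import Literature.Probability.Percolation.KozmaNitzanClusterProperty
import Summits.CriticalPhenomena.PercolationContinuityZ3.Theorems.PercNearOneGluingNoHeavyLowerTailCILReduction
import HarnessLib

/-!
# `NoHeavyLowerTail` (stmt-CriticalPhenomena-4575) — the cumulative isolation lemma whenever the
# observer is joined only to relays (Kozma–Nitzan's "`0` isolated in `G ∖ A`", any graph behind)

Support file for the crux `NoHeavyLowerTail` (routes `PercNearOneGluing`, `PercNearOneGluingNoHeavy`;
`--supports stmt-CriticalPhenomena-4575`), blob-quotient / cumulative-isolation line (depth prover
`nh-dp-blobmono`).  No definitions, no named facts, no sorries.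

Notation: `μ = prodBernoulli w` on `Fin n`, relays `A`, observer `o ∉ A`, `N = |{x ∈ A : o ↔ x}|`,
`π(a) = {x ∈ A : a ↔ x}`, level `j`.  The lead's typed engine for the crux is the CUMULATIVE ISOLATION
LEMMA `CIL_j : ∃ a ∈ A, μ{1 ≤ N ≤ j} ≤ μ{|π(a)| ≤ j}` (registered stub `stub_cumulativeIsolation`; it closes
the crux by `Theorems.noHeavyLowerTail_of_stub_cumulativeIsolation`).

## What is proved here

`cumulativeIsolation_of_isolatedObserver` — **CIL at every level `j`, for every number of relays and
EVERY weighted graph in which each positive-weight neighbour of the observer is a relay** (`w s(o,u) = 0`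
for `u ∉ A`, `u ≠ o`; behind the neighbours the graph is arbitrary: further relays, Steiner vertices,
cycles through several neighbours, any weights).  The witness is explicit: a relay `a₀` MINIMISING
`μ_{G∖{o}}(|π(a)| ≥ j+1)`, i.e. maximising the probability that its cluster is light in the graph with the
observer deleted; and the inequality holds in the sharper "pre-FKG" form
`μ{1 ≤ N ≤ j} ≤ μ{o ↔ A, |π(a₀)| ≤ j}` (`cumulativeIsolation_preFKG_of_isolatedObserver`).

Proof: Kozma–Nitzan's Theorem 8 (arXiv:2401.12397, §5.1 p. 32: their Conjecture 4 for monotone cluster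
properties holds when `0` is isolated in `G ∖ A`), reproduced in the tree for `{0,1}`-valued properties as
`Literature.Probability.Percolation.KozmaNitzan2024_thm8_event`, applied to the monotone vertex-set
property `S ↦ (j+1 ≤ |S ∩ A|)`: it gives `μ(|π(a₀)| ≥ j+1, o ↔ A) ≤ μ(|π(o)| ≥ j+1, o ↔ A) = μ(N ≥ j+1)`,
and `{1 ≤ N ≤ j} = {o ↔ A} ∖ {N ≥ j+1}` (as `o ∉ A`, `N ≥ 1 ⇔ o ↔ A`).

## Where it sits (for the lead / planners)

* It CONTAINS the landed cut-observer theorem `Theorems.cumulativeIsolation_cutObserver`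
  (`…CILCutObserver.lean`: the neighbours of `o` are port relays of pairwise non-communicating branches) —
  here the branches may be joined away from `o` in any way; it is exactly the sub-crux "NW-CIL"
  (neighbour-witness CIL, residual `(⋆⋆)`) isolated and verified numerically by the prover `prim-gen-induct`
  (crux notes `BLOBQUOTIENT.md` §5: 0/1350 violations with the witness rule `argmax_m μ_{G−o}{M_m ≤ j}`,
  which is the `a₀` above), now a theorem.
* Blob reading: every blob structure whose observer blob is the bare observer attached (by any number of
  edges, to any number of blobs) only through relay vertices satisfies CIL at every level — e.g. all blob
  quotients without Steiner vertices and with `m_{observer blob} = 0`; together with `CILBlobs.cil_of_glued`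
  (observer glued to a relay) this covers every Steiner-free quotient of the crux's census (kit j028329).
* What it does NOT cover is an observer with a positive-weight STEINER neighbour (`u ∉ A`): Kozma–Nitzan's
  Theorem 5 pattern (one extra vertex `x` joined only to `A ∪ {0}`) is the first such case; the general
  case is the crux.
-/

noncomputable section

namespace Summit.CriticalPhenomena.PercolationContinuityZ3.Theorems

open MeasureTheory Set Literature.Probability.LatticeModels Literature.Probability.Percolation
open scoped Classical BigOperators

variable {n : ℕ}

/-- The relay count of a cluster is a monotone function of the cluster (as a vertex set). [folklore] -/
theorem card_filter_mem_mono (A : Finset (Fin n)) {S T : Set (Fin n)} (hST : S ⊆ T) :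
    (A.filter fun x => x ∈ S).card ≤ (A.filter fun x => x ∈ T).card := by
  refine Finset.card_le_card fun x hx => ?_
  simp only [Finset.mem_filter] at hx ⊢
  exact ⟨hx.1, hST hx.2⟩

/-- `|π(a)|` read on the vertex cluster: `|{x ∈ A : x ∈ C(a)}| = |{x ∈ A : a ↔ x}|`. [folklore] -/
theorem card_filter_mem_openCluster (A : Finset (Fin n)) (ω : BondConfig (Fin n)) (a : Fin n) :
    (A.filter fun x => x ∈ openCluster ω a).card = (A.filter fun x => ω ∈ openConn a x).card := by
  have h : (A.filter fun x => x ∈ openCluster ω a) = (A.filter fun x => ω ∈ openConn a x) :=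
    Finset.filter_congr fun x _ => Iff.rfl
  rw [h]

/-- **CIL in pre-FKG form when the observer is joined only to relays.**  If `A ≠ ∅` and every
pair `s(o,u)` with `u ∉ A`, `u ≠ o` has weight `0` (the hypothesis `o ∉ A` of the stub is not needed), then for every level `j` some relay `a ∈ A` satisfies
`μ{1 ≤ N ≤ j} ≤ μ({o ↔ A} ∩ {|π(a)| ≤ j})`.  (Kozma–Nitzan's Theorem 8 for the cluster property
`|C(·) ∩ A| ≥ j+1`, `Literature.….KozmaNitzan2024_thm8_event`, and `{1 ≤ N ≤ j} = {o ↔ A} ∖ {N ≥ j+1}`.) [folklore] -/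
theorem cumulativeIsolation_preFKG_of_isolatedObserver (w : Sym2 (Fin n) → unitInterval)
    (A : Finset (Fin n)) (o : Fin n) (j : ℕ) (hA : A.Nonempty)
    (hiso : ∀ u, u ≠ o → u ∉ A → w s(o, u) = 0) :
    ∃ a ∈ A,
      (prodBernoulli w).real {ω : BondConfig (Fin n) |
          1 ≤ (A.filter fun x => ω ∈ openConn o x).card ∧
            (A.filter fun x => ω ∈ openConn o x).card ≤ j} ≤
        (prodBernoulli w).real ((⋃ a' ∈ A, (openConn o a' : Set (BondConfig (Fin n)))) ∩
          {ω : BondConfig (Fin n) | (A.filter fun x => ω ∈ openConn a x).card ≤ j}) := by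
  set μ := prodBernoulli w with hμ
  -- the monotone cluster property `|C ∩ A| ≥ j+1`
  set P : Set (Fin n) → Prop := fun S => j + 1 ≤ (A.filter fun x => x ∈ S).card with hP
  have hPmono : ∀ S T : Set (Fin n), S ⊆ T → P S → P T :=
    fun S T hST hS => le_trans hS (card_filter_mem_mono A hST)
  obtain ⟨a₀, ha₀, h8⟩ := KozmaNitzan2024_thm8_event w A o P hPmono hA hiso
  refine ⟨a₀, ha₀, ?_⟩
  set R : Set (BondConfig (Fin n)) := ⋃ a' ∈ A, (openConn o a' : Set (BondConfig (Fin n))) with hR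
  set Uo : Set (BondConfig (Fin n)) := {ω | P (openCluster ω o)} with hUo
  set Ua : Set (BondConfig (Fin n)) := {ω | P (openCluster ω a₀)} with hUa
  have hmemR : ∀ ω, ω ∈ R ↔ 1 ≤ (A.filter fun x => ω ∈ openConn o x).card := by
    intro ω
    rw [Nat.succ_le_iff, Finset.card_pos, Finset.filter_nonempty_iff]
    simp only [hR, mem_iUnion, exists_prop]
  -- `{1 ≤ N ≤ j} = R ∖ Uo`
  have hL : {ω : BondConfig (Fin n) | 1 ≤ (A.filter fun x => ω ∈ openConn o x).card ∧
      (A.filter fun x => ω ∈ openConn o x).card ≤ j} = R \ Uo := by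
    ext ω
    simp only [mem_setOf_eq, mem_sdiff, hmemR, hUo, hP, card_filter_mem_openCluster, not_le]
    omega
  -- `R ∖ Ua ⊆ R ∩ {|π(a₀)| ≤ j}`
  have hT : R \ Ua ⊆ R ∩ {ω : BondConfig (Fin n) | (A.filter fun x => ω ∈ openConn a₀ x).card ≤ j} := by
    rintro ω ⟨hωR, hωU⟩
    refine ⟨hωR, ?_⟩
    simp only [hUa, hP, mem_setOf_eq, card_filter_mem_openCluster, not_le] at hωU
    simp only [mem_setOf_eq]
    omega
  have e1 : μ.real (R ∩ Uo) + μ.real (R \ Uo) = μ.real R :=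
    measureReal_inter_add_sdiff (MeasurableSet.of_discrete : MeasurableSet Uo) (measure_ne_top _ _)
  have e2 : μ.real (R ∩ Ua) + μ.real (R \ Ua) = μ.real R :=
    measureReal_inter_add_sdiff (MeasurableSet.of_discrete : MeasurableSet Ua) (measure_ne_top _ _)
  have h8' : μ.real (R ∩ Ua) ≤ μ.real (R ∩ Uo) := by
    rw [inter_comm R Ua, inter_comm R Uo]
    exact h8
  rw [hL]
  calc μ.real (R \ Uo) = μ.real R - μ.real (R ∩ Uo) := by linarith
    _ ≤ μ.real R - μ.real (R ∩ Ua) := by linarith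
    _ = μ.real (R \ Ua) := by linarith
    _ ≤ μ.real (R ∩ {ω : BondConfig (Fin n) | (A.filter fun x => ω ∈ openConn a₀ x).card ≤ j}) :=
        measureReal_mono hT

/-- **The cumulative isolation lemma whenever the observer is joined only to relays** — the conclusion
of the registered stub `stub_cumulativeIsolation` (crux `NoHeavyLowerTail`, stmt-CriticalPhenomena-4575)
on this class: if `A ≠ ∅` and `w s(o,u) = 0` for every `u ∉ A`, `u ≠ o` (the graph behind the relay
neighbours being arbitrary; `o ∉ A` is not needed), then for every level `j` some relay `a ∈ A` has
`μ{1 ≤ N ≤ j} ≤ μ{|π(a)| ≤ j}`.  Strictly contains `Theorems.cumulativeIsolation_cutObserver` (independent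
branches).  From `cumulativeIsolation_preFKG_of_isolatedObserver`. [folklore] -/
theorem cumulativeIsolation_of_isolatedObserver (w : Sym2 (Fin n) → unitInterval)
    (A : Finset (Fin n)) (o : Fin n) (j : ℕ) (hA : A.Nonempty)
    (hiso : ∀ u, u ≠ o → u ∉ A → w s(o, u) = 0) :
    ∃ a ∈ A,
      (prodBernoulli w).real {ω : BondConfig (Fin n) |
          1 ≤ (A.filter fun x => ω ∈ openConn o x).card ∧
            (A.filter fun x => ω ∈ openConn o x).card ≤ j} ≤
        (prodBernoulli w).real {ω : BondConfig (Fin n) |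
          (A.filter fun x => ω ∈ openConn a x).card ≤ j} := by
  obtain ⟨a, ha, h⟩ := cumulativeIsolation_preFKG_of_isolatedObserver w A o j hA hiso
  exact ⟨a, ha, h.trans (measureReal_mono inter_subset_right)⟩

/-- **CIL on every Steiner-free weighted graph**: if every vertex other than the observer is a relay
(`A ∪ {o}` is everything; all blob quotients, any masses, any quotient graph, any weights), the cumulative
isolation lemma holds at every level. [folklore] -/
theorem cumulativeIsolation_of_noSteiner (w : Sym2 (Fin n) → unitInterval)
    (A : Finset (Fin n)) (o : Fin n) (j : ℕ) (hA : A.Nonempty) (hall : ∀ u, u ≠ o → u ∈ A) :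
    ∃ a ∈ A,
      (prodBernoulli w).real {ω : BondConfig (Fin n) |
          1 ≤ (A.filter fun x => ω ∈ openConn o x).card ∧
            (A.filter fun x => ω ∈ openConn o x).card ≤ j} ≤
        (prodBernoulli w).real {ω : BondConfig (Fin n) |
          (A.filter fun x => ω ∈ openConn a x).card ≤ j} :=
  cumulativeIsolation_of_isolatedObserver w A o j hA fun u huo huA => absurd (hall u huo) huA

/-- **The crux `NoHeavyLowerTail` holds on every weighted graph whose observer is joined only to relays**
(uniformly: `δ := ε/3`, for every `|A|` and every weight; in particular on every STEINER-FREE weighted graph,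
i.e. on every blob quotient of the crux's census).  From `cumulativeIsolation_of_isolatedObserver` at the
level `j = ⌊|A|/2⌋` and pair counting (`Theorems.smallBlock_le_two_mul`: `μ{2|π(a)| ≤ |A|} ≤ 2η` when all
cuts at `a` are `≤ η`): with `δ = ε/3` the threshold `δ·E N/ε = E N/3 ≤ |A|/3` forces `N ≤ ⌊|A|/2⌋`, so the
lower-tail mass is `≤ μ{|π(a)| ≤ ⌊|A|/2⌋} ≤ 2ε/3 < ε`.  The reach hypothesis `P(o ↔ A) > 1 − δ` of the crux is
not used. [folklore] -/
theorem noHeavyLowerTail_of_isolatedObserver :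
    ∀ ε : ℝ, 0 < ε → ∃ δ : ℝ, 0 < δ ∧ ∀ (n : ℕ) (w : Sym2 (Fin n) → unitInterval) (A : Finset (Fin n))
      (o : Fin n), (∀ u, u ≠ o → u ∉ A → w s(o, u) = 0) →
      (∀ a ∈ A, ∀ a' ∈ A, 1 - δ < (Literature.Probability.LatticeModels.prodBernoulli w).real
        (Literature.Probability.Percolation.openConn a a')) →
      (Literature.Probability.LatticeModels.prodBernoulli w).real
        {ω | 1 ≤ (A.filter fun a => ω ∈ Literature.Probability.Percolation.openConn o a).card ∧
          ((A.filter fun a => ω ∈ Literature.Probability.Percolation.openConn o a).card : ℝ) <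
            δ * (∑ a ∈ A, (Literature.Probability.LatticeModels.prodBernoulli w).real
              (Literature.Probability.Percolation.openConn o a)) / ε} < ε := by
  intro ε hε
  refine ⟨ε / 3, by positivity, ?_⟩
  intro n w A o hiso hpair
  set μ := prodBernoulli w with hμ
  rcases A.eq_empty_or_nonempty with hAe | hAne
  · -- no relays: the event is empty
    have hempty : {ω : BondConfig (Fin n) | 1 ≤ (A.filter fun a => ω ∈ openConn o a).card ∧
        ((A.filter fun a => ω ∈ openConn o a).card : ℝ) <
          ε / 3 * (∑ a ∈ A, μ.real (openConn o a)) / ε} = ∅ := by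
      ext ω
      simp [hAe]
    rw [hempty, measureReal_empty]
    exact hε
  · have ht : ∀ a ∈ A, ∀ a' ∈ A, μ.real (openConn a a')ᶜ ≤ ε / 3 := by
      intro a ha a' ha'
      rw [probReal_compl_eq_one_sub (measurableSet_openConn_holds a a')]
      linarith [hpair a ha a' ha']
    obtain ⟨a, ha, hCIL⟩ := cumulativeIsolation_of_isolatedObserver w A o (A.card / 2) hAne hiso
    have h2 := smallBlock_le_two_mul w A a (ε / 3) ha (fun a' ha' => ht a ha a' ha')
    have hEN : (∑ a ∈ A, μ.real (openConn o a)) ≤ (A.card : ℝ) := by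
      calc (∑ a ∈ A, μ.real (openConn o a)) ≤ ∑ _a ∈ A, (1 : ℝ) :=
            Finset.sum_le_sum fun a _ => measureReal_le_one
        _ = (A.card : ℝ) := by simp
    -- the crux's event lies in `{1 ≤ N ≤ ⌊|A|/2⌋}`
    have hsub1 : {ω : BondConfig (Fin n) | 1 ≤ (A.filter fun a => ω ∈ openConn o a).card ∧
        ((A.filter fun a => ω ∈ openConn o a).card : ℝ) <
          ε / 3 * (∑ a ∈ A, μ.real (openConn o a)) / ε} ⊆
        {ω : BondConfig (Fin n) | 1 ≤ (A.filter fun x => ω ∈ openConn o x).card ∧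
          (A.filter fun x => ω ∈ openConn o x).card ≤ A.card / 2} := by
      intro ω hω
      simp only [Set.mem_setOf_eq] at hω ⊢
      refine ⟨hω.1, ?_⟩
      have hthr : ε / 3 * (∑ a ∈ A, μ.real (openConn o a)) / ε =
          (∑ a ∈ A, μ.real (openConn o a)) / 3 := by
        field_simp
      have hlt : (3 : ℝ) * ((A.filter fun a => ω ∈ openConn o a).card : ℝ) < (A.card : ℝ) := by
        rw [hthr] at hω
        linarith [hω.2]
      have hlt' : 3 * (A.filter fun a => ω ∈ openConn o a).card < A.card := by exact_mod_cast hlt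
      omega
    -- `{|π(a)| ≤ ⌊|A|/2⌋} ⊆ {2|π(a)| ≤ |A|}`
    have hsub2 : {ω : BondConfig (Fin n) | (A.filter fun x => ω ∈ openConn a x).card ≤ A.card / 2} ⊆
        {ω : BondConfig (Fin n) | 2 * (A.filter fun a' => ω ∈ openConn a a').card ≤ A.card} := by
      intro ω hω
      simp only [Set.mem_setOf_eq] at hω ⊢
      omega
    calc μ.real _ ≤ μ.real {ω : BondConfig (Fin n) | 1 ≤ (A.filter fun x => ω ∈ openConn o x).card ∧
          (A.filter fun x => ω ∈ openConn o x).card ≤ A.card / 2} := measureReal_mono hsub1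
      _ ≤ μ.real {ω : BondConfig (Fin n) | (A.filter fun x => ω ∈ openConn a x).card ≤ A.card / 2} := hCIL
      _ ≤ μ.real {ω : BondConfig (Fin n) | 2 * (A.filter fun a' => ω ∈ openConn a a').card ≤ A.card} :=
          measureReal_mono hsub2
      _ ≤ 2 * (ε / 3) := h2
      _ < ε := by linarith

/-- **In particular: the crux on STEINER-FREE graphs.**  If every vertex other than the observer is a
relay (`A ∪ {o}` is everything — all blob quotients of the census, with any masses and any quotient
graph), `NoHeavyLowerTail`'s conclusion holds with `δ := ε/3`. [folklore] -/
theorem noHeavyLowerTail_of_noSteiner :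
    ∀ ε : ℝ, 0 < ε → ∃ δ : ℝ, 0 < δ ∧ ∀ (n : ℕ) (w : Sym2 (Fin n) → unitInterval) (A : Finset (Fin n))
      (o : Fin n), (∀ u, u ≠ o → u ∈ A) →
      (∀ a ∈ A, ∀ a' ∈ A, 1 - δ < (Literature.Probability.LatticeModels.prodBernoulli w).real
        (Literature.Probability.Percolation.openConn a a')) →
      (Literature.Probability.LatticeModels.prodBernoulli w).real
        {ω | 1 ≤ (A.filter fun a => ω ∈ Literature.Probability.Percolation.openConn o a).card ∧
          ((A.filter fun a => ω ∈ Literature.Probability.Percolation.openConn o a).card : ℝ) <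
            δ * (∑ a ∈ A, (Literature.Probability.LatticeModels.prodBernoulli w).real
              (Literature.Probability.Percolation.openConn o a)) / ε} < ε := by
  intro ε hε
  obtain ⟨δ, hδ, h⟩ := noHeavyLowerTail_of_isolatedObserver ε hε
  exact ⟨δ, hδ, fun n w A o hall hpair => h n w A o (fun u huo huA => absurd (hall u huo) huA) hpair⟩

end Summit.CriticalPhenomena.PercolationContinuityZ3.Theorems

end
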